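import Mathlib
import Literature.NumberTheory.LFunctions.GeneralizedRH
import Literature.NumberTheory.LFunctions.ZetaRealAxis
import Literature.NumberTheory.LFunctions.ZetaFirstZeroCertificate

/-!
# RiemannHypothesis / MayerPairing — the ζ-side bookkeeping `NontrivialZeroLocus`, route-file-independent

Route `RiemannHypothesis/MayerPairing`, support item stmt-RiemannHypothesis-13909
(`NontrivialZeroLocus`): every non-trivial zero `s` of `ζ` (`ζ s = 0`, `s ≠ -2(n+1)`, `s ≠ 1`)
lies in the open critical strip `0 < Re s < 1` and has `|Im s| > 14`.

This module re-proves, with the statement spelled STRUCTURALLY (verbatim the item's term), the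
theorem `mayerPairing_nontrivialZeroLocus` of `Theorems/MayerPairingNontrivialZeroLocus.lean`
(which closed the earlier copy stmt-RiemannHypothesis-9431 of this item). That module imports the
route file `Summits.RiemannHypothesis.RiemannHypothesis.Theses.MayerPairing`, so the gate cannot link
it into the route file as `import <proving module>` + `theorem NontrivialZeroLocus_holds` (import
cycle; route revision 3, 2026-08-15). This module imports NEITHER the route file NOR any
`Theorems/MayerPairing*.lean`, only Mathlib and three Literature modules — the same device as
`Theorems/UniversalFactor*Standalone.lean`.

Ingredients, all in the tree:

* `Re s < 1` — Mathlib `riemannZeta_ne_zero_of_one_le_re` (Hadamard–de la Vallée Poussin);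
* `0 < Re s` — `Literature.NumberTheory.LFunctions.riemannZeta_eq_zero_iff_of_re_nonpos`
  (a zero with `Re s ≤ 0` is a trivial zero; functional equation);
* `Im s ≠ 0` — `Literature.NumberTheory.LFunctions.im_ne_zero_of_riemannZeta_eq_zero`
  (no real zeros in `(0,1)`);
* `|Im s| > 14` — `Literature.NumberTheory.LFunctions.riemannZeta_ne_zero_of_im_pos_of_im_le_fourteen`
  (the certified first-zero count `N(14) = 0`), at `s` or at `conj s` (Mathlib `riemannZeta_conj`).

References: E. C. Titchmarsh, *The Theory of the Riemann Zeta-Function*, §2.12;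
H. M. Edwards, *Riemann's Zeta Function*, §6.6.
-/

namespace Summit.RiemannHypothesis.RiemannHypothesis.Theorems

open Literature.NumberTheory.LFunctions

/-- **Support item `NontrivialZeroLocus` (stmt-RiemannHypothesis-13909), route-file-independent
form.** Every non-trivial zero `s` of `ζ` satisfies `0 < Re s < 1` and `14 < |Im s|`: the strip by
Hadamard–de la Vallée Poussin (`Re s < 1`) and the functional equation (`Re s ≤ 0` forces a trivial
zero); `Im s ≠ 0` because `ζ` has no zeros on the real segment `(0,1)`; and `|Im s| > 14` by the
in-tree certificate that `ζ` has no zeros with `0 < Im s ≤ 14`, applied at `s` or at `conj s`.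
The type is verbatim the term of `Summit.RiemannHypothesis.RiemannHypothesis.Theses.MayerPairing.NontrivialZeroLocus`
(so `example : NontrivialZeroLocus := MayerPairingStandalone.nontrivialZeroLocus` elaborates by
unfolding), stated without importing the route file. [folklore] -/
theorem MayerPairingStandalone.nontrivialZeroLocus :
    ∀ s : ℂ, riemannZeta s = 0 → (¬ ∃ n : ℕ, s = -2 * (n + 1)) → s ≠ 1 →
      0 < s.re ∧ s.re < 1 ∧ (14 : ℝ) < |s.im| := by
  intro s hs htriv _h1
  -- the open strip
  have hre0 : 0 < s.re := by
    by_contra hle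
    obtain ⟨n, hn⟩ := (riemannZeta_eq_zero_iff_of_re_nonpos (not_lt.1 hle)).1 hs
    exact htriv ⟨n, hn⟩
  have hre1 : s.re < 1 := by
    by_contra hge
    exact riemannZeta_ne_zero_of_one_le_re (not_lt.1 hge) hs
  refine ⟨hre0, hre1, ?_⟩
  -- off the real axis
  have him : s.im ≠ 0 := im_ne_zero_of_riemannZeta_eq_zero hs hre0 hre1
  rcases lt_or_gt_of_ne him with hneg | hpos
  · -- lower half-plane: pass to the conjugate zero
    have hconj : riemannZeta (starRingEnd ℂ s) = 0 := by
      rw [riemannZeta_conj, hs, map_zero]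
    have hpos' : 0 < (starRingEnd ℂ s).im := by
      rw [Complex.conj_im]
      linarith
    by_contra hle
    have hle' : (starRingEnd ℂ s).im ≤ 14 := by
      rw [Complex.conj_im]
      rw [abs_of_neg hneg] at hle
      linarith
    exact riemannZeta_ne_zero_of_im_pos_of_im_le_fourteen hpos' hle' hconj
  · by_contra hle
    have hle' : s.im ≤ 14 := by
      rw [abs_of_pos hpos] at hle
      linarith
    exact riemannZeta_ne_zero_of_im_pos_of_im_le_fourteen hpos hle' hs

end Summit.RiemannHypothesis.RiemannHypothesis.Theorems
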